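import Literature.NumberTheory.Irrationality.Zudilin2014.SecondTaleArithmetic
import Literature.NumberTheory.Irrationality.Zudilin2014.SecondTalePadic
import Literature.NumberTheory.Transcendental.ZudilinLemma19
import Summits.KontsevichZagierPeriods.Zeta5Search.TwoTaleWhippleD1

/-!
# RUNG D1 = L(1/3), second tale: the CRUDE all-prime bound for `p̂_n` — from Prop. 3, no zones (file F9 of the D1 note)

HONEST FRAMING: systematic search; no irrationality claim unless certified.  Cell pub-zeta5 (P1 g12 draft of F9 of
fam-denom's `families/denom/D1-DESIGN-NOTE.md`; design credit fam-denom; offered, fam-denom may take it back by one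
line).  Denominator side only; nothing about irrationality.

The note planned F9 as a clone of the P15 file `TwoTaleP15SecondTaleCrude` (zone-by-zone closed forms of `B_k`, which
at D1 would need the D1 analogue of the P15 `SecondTaleB*` stack).  None of that is needed: the tree ALREADY holds
Zudilin's Proposition 3 for `p̂` in general position, `Zudilin2014.exists_int_lcm_mul_formPT`
(`D_{ĉ₁} D_{ĉ₂} p̂(â,b̂) ∈ ℤ` for `ĉ₁ ≥ max{â₀−b̂₀, â₁−b̂₁, b̂₃*−â₂−1, b̂₃*−â₃−1, 2b̂₂*−â₀*−2}`, `ĉ₂ ≥ 2b̂₃*−â₀*−2`)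
[cite: Zudilin2014ZetaTwo, Proposition 3].  At the D1 partner `(47n+2; 16n+1, 19n+1, 22n+1 | 22n+2; 9n+1, 35n+2, 38n+2)`
these maxima are `25n, 7n, 19n, 16n, 32n` and `38n`, so `D₃₂ₙ D₃₈ₙ p̂_n ∈ ℤ` (`exists_int_lcm_mul_formPT_D1`), whence for
EVERY prime `p` (multi-digit primes included)

* **`padicNorm_formPT_D1_le_log : 1 ≤ n → ‖formPT (aTD1 n) (bTD1 n)‖_p ≤ p^{⌊log_p 32n⌋ + ⌊log_p 38n⌋}`**

(`v_p(D_c) = ⌊log_p c⌋`, tree `Zudilin2004.padicValNat_lcmUpto`), and the integer form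
`padicNorm_pow_mul_formPT_D1_le_one : ‖p^{⌊log_p 32n⌋+⌊log_p 38n⌋} · p̂_n‖_p ≤ 1` consumed by the common-cells file F10
for the primes `p < √(76n+4)` (their product is `e^{O(√n log n)}`, rate 0).  The generic step
`padicNorm_le_log_of_lcm_mul` is stated for any `q` with `D_{c₁} D_{c₂} q ∈ ℤ`.
-/

noncomputable section

namespace Summit.KontsevichZagierPeriods.Zeta5Search.Denom.TwoTaleD1Crude

open Finset
open Literature.NumberTheory.Irrationality.Zudilin2014
open Literature.NumberTheory.Transcendental.Zudilin2004 (padicValNat_lcmUpto)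
open Summit.KontsevichZagierPeriods.Zeta5Search.Denom.TwoTaleD1Forms (aTD1 bTD1 aTD1_zero aTD1_one aTD1_two
  aTD1_three bTD1_zero bTD1_one bTD1_two bTD1_three)
open Summit.KontsevichZagierPeriods.Zeta5Search.TwoTaleWhippleD1 (admissibleTD1)

variable {n : ℕ} {p : ℕ} [hp : Fact p.Prime]

/-- `‖1/D_c‖_p = p^{⌊log_p c⌋}` (`D_c = lcm(1,…,c)`, `v_p(D_c) = ⌊log_p c⌋`). -/
theorem padicNorm_inv_lcmUpto (c : ℕ) : padicNorm p (((Nat.lcmUpto c : ℕ) : ℚ))⁻¹ = (p : ℚ) ^ (Nat.log p c) := by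
  have hD : ((Nat.lcmUpto c : ℕ) : ℚ) ≠ 0 := by exact_mod_cast (Nat.lcmUpto_pos c).ne'
  rw [padicNorm.eq_zpow_of_nonzero (inv_ne_zero hD), padicValRat.inv, neg_neg, padicValRat.of_nat,
    padicValNat_lcmUpto, zpow_natCast]

/-- **Generic crude bound**: if `D_{c₁} D_{c₂} q ∈ ℤ` then `‖q‖_p ≤ p^{⌊log_p c₁⌋ + ⌊log_p c₂⌋}` for every prime `p`. -/
theorem padicNorm_le_log_of_lcm_mul {c₁ c₂ : ℕ} {q : ℚ} {z : ℤ}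
    (h : ((Nat.lcmUpto c₁ * Nat.lcmUpto c₂ : ℕ) : ℚ) * q = z) :
    padicNorm p q ≤ (p : ℚ) ^ (Nat.log p c₁ + Nat.log p c₂) := by
  have hD1 : ((Nat.lcmUpto c₁ : ℕ) : ℚ) ≠ 0 := by exact_mod_cast (Nat.lcmUpto_pos c₁).ne'
  have hD2 : ((Nat.lcmUpto c₂ : ℕ) : ℚ) ≠ 0 := by exact_mod_cast (Nat.lcmUpto_pos c₂).ne'
  have e : q = (z : ℚ) * (((Nat.lcmUpto c₁ : ℕ) : ℚ))⁻¹ * (((Nat.lcmUpto c₂ : ℕ) : ℚ))⁻¹ := by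
    rw [← h]; push_cast; field_simp
  rw [e, padicNorm.mul, padicNorm.mul, padicNorm_inv_lcmUpto, padicNorm_inv_lcmUpto, pow_add, mul_assoc]
  exact mul_le_of_le_one_left (by positivity) (padicNorm.of_int z)

/-- **Prop. 3 at D1**: `D₃₂ₙ · D₃₈ₙ · p̂_n ∈ ℤ` [cite: Zudilin2014ZetaTwo, Proposition 3] (tree
`exists_int_lcm_mul_formPT`; the six lower bounds are `25n, 7n, 19n, 16n, 32n ≤ 32n` and `38n ≤ 38n`). -/
theorem exists_int_lcm_mul_formPT_D1 (hn : 1 ≤ n) :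
    ∃ z : ℤ, ((Nat.lcmUpto (32 * n) * Nat.lcmUpto (38 * n) : ℕ) : ℚ) * formPT (aTD1 n) (bTD1 n) = z := by
  refine exists_int_lcm_mul_formPT (admissibleTD1 hn) ?_ ?_ ?_ ?_ ?_ ?_
  · simp; omega
  · simp; omega
  · unfold bMax; simp; omega
  · unfold bMax; simp; omega
  · unfold bMin a0star aMid; simp; omega
  · unfold bMax a0star aMid; simp; omega

/-- **The crude all-prime bound at D1**: `‖p̂_n‖_p ≤ p^{⌊log_p 32n⌋ + ⌊log_p 38n⌋}` for EVERY prime `p`, `n ≥ 1`. -/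
theorem padicNorm_formPT_D1_le_log (hn : 1 ≤ n) :
    padicNorm p (formPT (aTD1 n) (bTD1 n)) ≤ (p : ℚ) ^ (Nat.log p (32 * n) + Nat.log p (38 * n)) := by
  obtain ⟨z, hz⟩ := exists_int_lcm_mul_formPT_D1 hn
  exact padicNorm_le_log_of_lcm_mul hz

/-- Monotone repackaging: `‖p̂_n‖_p ≤ p^{2⌊log_p 38n⌋}`. -/
theorem padicNorm_formPT_D1_le_log' (hn : 1 ≤ n) :
    padicNorm p (formPT (aTD1 n) (bTD1 n)) ≤ (p : ℚ) ^ (2 * Nat.log p (38 * n)) := by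
  refine (padicNorm_formPT_D1_le_log hn).trans (pow_le_pow_right₀ (by exact_mod_cast hp.out.one_lt.le) ?_)
  have : Nat.log p (32 * n) ≤ Nat.log p (38 * n) := Nat.log_mono_right (by omega)
  omega

/-- Integer form for the common-cells file: `‖p^{⌊log_p 32n⌋+⌊log_p 38n⌋} · p̂_n‖_p ≤ 1` for every prime `p`. -/
theorem padicNorm_pow_mul_formPT_D1_le_one (hn : 1 ≤ n) :
    padicNorm p ((p : ℚ) ^ (Nat.log p (32 * n) + Nat.log p (38 * n)) * formPT (aTD1 n) (bTD1 n)) ≤ 1 := by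
  have hp0 : (p : ℚ) ≠ 0 := by exact_mod_cast hp.out.ne_zero
  have hpow : padicNorm p ((p : ℚ) ^ (Nat.log p (32 * n) + Nat.log p (38 * n)))
      = ((p : ℚ) ^ (Nat.log p (32 * n) + Nat.log p (38 * n)))⁻¹ := by
    rw [padicNorm.eq_zpow_of_nonzero (pow_ne_zero _ hp0), padicValRat.pow, padicValRat.self hp.out.one_lt,
      mul_one, zpow_neg, zpow_natCast]
  rw [padicNorm.mul, hpow, inv_mul_le_iff₀ (by positivity), mul_one]
  exact padicNorm_formPT_D1_le_log hn

/-! ### The free window bound (Lemma 8 with `e = 0`) -/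

omit hp in
/-- The right-hand side of (T3a) is a sum of four carries, hence `≥ 0` (generic). -/
theorem digitT_nonneg (hp0 : 0 < p) (a b : Fin 4 → ℤ) (k : ℤ) : 0 ≤ digitT p a b k := by
  unfold digitT
  have h := fun M x => (fdig_nonneg_le_one hp0 M x).1
  linarith [h (2 * k - b 0) (a 0 - b 0), h (k - b 1) (a 1 - b 1), h (b 2 - a 2 - 1) (k - a 2),
    h (b 3 - a 3 - 1) (k - a 3)]

/-- **Free window bound at D1** (Lemma 8 for `p̂` with `e = 0`): `‖p̂_n‖_p ≤ p²` for every prime with `76n + 4 ≤ p²`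
(the generic `padicNorm_formPT_le` [cite: Zudilin2014ZetaTwo, Lemma 8] and `digitT_nonneg`). -/
theorem padicNorm_formPT_D1_le_sq (hn : 1 ≤ n) (hp2 : 76 * n + 4 ≤ p ^ 2) :
    padicNorm p (formPT (aTD1 n) (bTD1 n)) ≤ (p : ℚ) ^ (2 : ℤ) := by
  have hp2' : 2 * bMax (bTD1 n) ≤ (p : ℤ) ^ 2 := by
    unfold bMax; simp only [bTD1_two, bTD1_three]
    have : (76 * n + 4 : ℤ) ≤ (p : ℤ) ^ 2 := by exact_mod_cast hp2
    rw [max_eq_right (by omega)]; linarith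
  have h := padicNorm_formPT_le (admissibleTD1 hn) (by simp; positivity) (by simp; positivity) hp2' (e := 0)
    (fun k _ => digitT_nonneg hp.out.pos _ _ k)
  simpa using h

/-- `‖q̂_n‖_p ≤ 1` for every prime with `76n + 4 ≤ p²` (Lemma 8 for `q̂` with `e = 0`). -/
theorem padicNorm_formQT_D1_le_one (hn : 1 ≤ n) (hp2 : 76 * n + 4 ≤ p ^ 2) :
    padicNorm p (formQT (aTD1 n) (bTD1 n)) ≤ 1 := by
  have hp2' : 2 * bMax (bTD1 n) ≤ (p : ℤ) ^ 2 := by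
    unfold bMax; simp only [bTD1_two, bTD1_three]
    have : (76 * n + 4 : ℤ) ≤ (p : ℤ) ^ 2 := by exact_mod_cast hp2
    rw [max_eq_right (by omega)]; linarith
  have h := padicNorm_formQT_le (admissibleTD1 hn) (by simp; positivity) (by simp; positivity) hp2' (e := 0)
    (fun k _ => digitT_nonneg hp.out.pos _ _ k)
  simpa using h

end Summit.KontsevichZagierPeriods.Zeta5Search.Denom.TwoTaleD1Crude

end
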